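import Summits.CriticalPhenomena.SAWScalingLimit.Theorems.SubseqIdentification.Negative.Necessity
import Mathlib.MeasureTheory.Measure.Portmanteau

/-!
# Stub `stub_portmanteau` of crux `LimitExists` (stmt-CriticalPhenomena-1371), line `registered`

The two portmanteau inequalities (closed sets / open sets) for a probability weak limit `ν` of the
pushed-forward critical SAW laws `Pₙ := (SAW.law Ω (s n) (a (s n)) (b (s n))).map (·.curve)` along a
sequence of meshes.  `SAW.law` is a probability measure or the zero measure; testing the weak
convergence hypothesis with `f ≡ 1` shows the laws are probability measures EVENTUALLY
(`eventually_isProbabilityMeasure_of_tendsto`), so Mathlib's portmanteau theorem for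
`ProbabilityMeasure` applies to an eventually-equal surrogate sequence.  This is the inlined opening
of `avoidancePassage_proof` (stmt-CriticalPhenomena-4984), made a named lemma for an arbitrary `Ω`.
-/

noncomputable section

open MeasureTheory Filter Topology Set
open scoped ENNReal MeasureTheory Topology BoundedContinuousFunction
open Literature.Probability.RandomPlanarGeometry Literature.Probability.LatticeModels

namespace Summit.CriticalPhenomena.SAWScalingLimit.Theorems.SAWRestrictionRigidityLimitExists

open Summit.CriticalPhenomena.SAWScalingLimit.Theorems.SubseqIdentification.Negative
  (eventually_isProbabilityMeasure_of_tendsto)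

/-- **Portmanteau for the pushed-forward critical SAW laws.**  If `ν` is a probability measure on
`CurveClass ℂ` and `∫ f (γ.curve) dPₙ → ∫ f dν` for every bounded continuous `f`, where `Pₙ` is the
critical SAW law of `(Ω; a (s n), b (s n))` at mesh `s n`, then for every closed `C`,
`limsup Pₙ(curve ∈ C) ≤ ν C`, and for every open `G`, `ν G ≤ liminf Pₙ(curve ∈ G)`.  (The laws have
mass `0` or `1`, hence are probability measures eventually since the masses tend to `ν univ = 1`;
then Mathlib's `ProbabilityMeasure.limsup_measure_closed_le_of_tendsto` /
`le_liminf_measure_open_of_tendsto` along an eventually-equal `ProbabilityMeasure`-valued sequence.)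
[cite: BillingsleyCPM1999, Thm. 2.1] -/
theorem stub_portmanteau : ∀ (Ω : Set ℂ) (a b : ℝ → Literature.Probability.LatticeModels.Site 2) (s : ℕ → ℝ) (ν : MeasureTheory.Measure (Literature.Probability.RandomPlanarGeometry.CurveClass ℂ)), MeasureTheory.IsProbabilityMeasure ν → (∀ f : BoundedContinuousFunction (Literature.Probability.RandomPlanarGeometry.CurveClass ℂ) ℝ, Filter.Tendsto (fun n => ∫ γ, f γ.curve ∂(Literature.Probability.RandomPlanarGeometry.SAW.law Ω (s n) (a (s n)) (b (s n)))) Filter.atTop (nhds (∫ x, f x ∂ν))) → (∀ C : Set (Literature.Probability.RandomPlanarGeometry.CurveClass ℂ), IsClosed C → Filter.limsup (fun n => ((Literature.Probability.RandomPlanarGeometry.SAW.law Ω (s n) (a (s n)) (b (s n))).map (fun γ => γ.curve)) C) Filter.atTop ≤ ν C) ∧ (∀ G : Set (Literature.Probability.RandomPlanarGeometry.CurveClass ℂ), IsOpen G → ν G ≤ Filter.liminf (fun n => ((Literature.Probability.RandomPlanarGeometry.SAW.law Ω (s n) (a (s n)) (b (s n))).map (fun γ => γ.curve)) G) Filter.atTop)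 := by
  intro Ω a b s ν hν hweak
  classical
  -- notation: the pushed-forward laws
  set P : ℕ → Measure (CurveClass ℂ) := fun n =>
    (SAW.law Ω (s n) (a (s n)) (b (s n))).map (fun γ => γ.curve) with hP
  have hmeas : ∀ n, Measurable
      (fun γ : SAW.DomainSAW Ω (s n) (a (s n)) (b (s n)) => γ.curve) := fun n =>
    SAW.DomainSAW.measurable_of_top _
  -- weak convergence of the pushed-forward laws
  have hweakP : ∀ f : BoundedContinuousFunction (CurveClass ℂ) ℝ,
      Tendsto (fun n => ∫ x, f x ∂(P n)) atTop (𝓝 (∫ x, f x ∂ν)) := fun f => by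
    have hint : ∀ n, ∫ x, f x ∂(P n) =
        ∫ γ, f γ.curve ∂(SAW.law Ω (s n) (a (s n)) (b (s n))) := fun n =>
      integral_map (hmeas n).aemeasurable f.continuous.aestronglyMeasurable
    simp only [hint]
    exact hweak f
  -- the laws are probability measures eventually (test `f ≡ 1`)
  have hevP : ∀ᶠ n in atTop, IsProbabilityMeasure (P n) := by
    filter_upwards [eventually_isProbabilityMeasure_of_tendsto (μ := ν) (hweak 1)] with n hn
    exact Measure.isProbabilityMeasure_map (hmeas n).aemeasurable
  -- the laws as probability measures (eventually), and portmanteau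
  let Q : ℕ → ProbabilityMeasure (CurveClass ℂ) := fun n =>
    if h : IsProbabilityMeasure (P n) then (⟨P n, h⟩ : ProbabilityMeasure (CurveClass ℂ))
    else (⟨ν, hν⟩ : ProbabilityMeasure (CurveClass ℂ))
  have hQP : ∀ᶠ n in atTop, (Q n : Measure (CurveClass ℂ)) = P n := by
    filter_upwards [hevP] with n hn
    simp only [Q, dif_pos hn, ProbabilityMeasure.coe_mk]
  have hQlim : Tendsto Q atTop (𝓝 (⟨ν, hν⟩ : ProbabilityMeasure (CurveClass ℂ))) := by
    rw [ProbabilityMeasure.tendsto_iff_forall_integral_tendsto]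
    intro f
    refine (hweakP f).congr' ?_
    filter_upwards [hQP] with n hn
    rw [hn]
  refine ⟨fun C hC => ?_, fun G hG => ?_⟩
  · -- closed sets
    have h := ProbabilityMeasure.limsup_measure_closed_le_of_tendsto hQlim hC
    have heq : (fun n => P n C) =ᶠ[atTop] fun n => (Q n : Measure (CurveClass ℂ)) C :=
      hQP.mono fun n hn => by simp only [hn]
    show limsup (fun n => P n C) atTop ≤ ν C
    rw [limsup_congr heq]
    exact h
  · -- open sets
    have h := ProbabilityMeasure.le_liminf_measure_open_of_tendsto hQlim hG
    have heq : (fun n => P n G) =ᶠ[atTop] fun n => (Q n : Measure (CurveClass ℂ)) G :=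
      hQP.mono fun n hn => by simp only [hn]
    show ν G ≤ liminf (fun n => P n G) atTop
    rw [liminf_congr heq]
    exact h

end Summit.CriticalPhenomena.SAWScalingLimit.Theorems.SAWRestrictionRigidityLimitExists
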